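-- PORTED from the prior programme stockroom (kernel-checked there, proofs untouched):
--   reserve/prior-2001/Prior/HodgeConjecture/HodgeConjecture/Hodge_WRankFourWeilFacesY1_RfwfReflexLemma.lean
-- Changes: `import HarnessLib` dropped; outer namespace -> HodgeCM.Prior.ReflexLemma. Attribution: 2001 programme seats (docstrings).

import Mathlib

/-!
# Prior-program stockroom file `Hodge_WRankFourWeilFacesY1_RfwfReflexLemma`

Imported from the 2001 program: `summits/hodge-w-rank-four-weil-faces/free/y1/lean/RfwfReflexLemma.lean` (commit a463a4c8cc18),
free `y1` of summit `hodge-w-rank-four-weil-faces`; prior STATUS `upheld`; imported 2026-08-13.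
Relevant to: Summit.HodgeConjecture.HodgeConjecture (the statement via the prior narrowed target `hodge-w-rank-four-weil-faces`); container free `y1`
Inspiration note: none (not a primary-summit route).
Existing Theses decls it bears on: not assessed at import (planners/provers decide; see reserve/prior-2001/README.md).
Mechanical changes only: provenance header, whole body wrapped in the namespace below (original namespaces nested
inside), stub docstrings on undocumented declarations, `#print`/`#check`/`#eval` lines dropped. Proofs untouched.
NOT part of the `lean/` tree: it enters `Summits/…/Theorems` only when a prover adapts it to a Theses decl (route item).
-/

namespace HodgeCM.Prior.ReflexLemma

/-
T3 — rfwf Lemma 3.1 ("Reflex of the inverted corners", label l:reflex),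
source: summits/hodge-w-rank-four-weil-faces/free/y1/paper/paper.tex (v2), lines 147-183,
definitions from lines 42-49 (§1) and 148-152 (§3 preamble).

Setting formalized: a group G, an element c (complex conjugation; the source has c central
with c*c = 1 — each lemma below carries exactly the hypotheses it needs, never more than
"c*c = 1", "c central", the CM-type property, and for the base point that φh is central
with φh*φh = 1, which `phih_central_invol` derives from φh ∈ {1, c}),
CM types as subsets Φ ⊆ G with G = Φ ⊔ cΦ, encoded pointwise: ∀ x, x ∈ Φ ↔ c*x ∉ Φ.

Dictionary with the paper (Galois theory replaced by its group-theoretic image):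
  Θ ∋ 1 CM type, H' = {u : Θu = Θ} (right stabiliser), K' = F^{H'}   ⟶  rightStab Θ
  Ψ := φh Θ⁻¹                                                        ⟶  psi φh Θ
  Stab(Ψ) = {s : sΨ = Ψ}                                             ⟶  stabSet (psi φh Θ)
  A_Ψ = {τ : τ⁻¹ φh ∈ Ψ}                                             ⟶  Acorner φh Ψ
  τ ↦ τ|_{K'}  (restriction to the fixed field of H')                ⟶  QuotientGroup.mk : G → G ⧸ rightStab Θ
  θ = {u|_{K'} : u ∈ Θ},  Ψ* = {τ|_{F*_Ψ} : τ ∈ A_Ψ}                 ⟶  mk '' Θ,  mk '' (Acorner φh (psi φh Θ))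
  Θ g₀⁻¹  (right translate)                                          ⟶  rtransl Θ g₀ = {x | x*g₀ ∈ Θ}
What is NOT here (geometry, cited by the paper to [ST II.§5], [MilCM §3], [Y1neg]): the
abelian varieties B*_Ψ, End⁰(B*_Ψ) = K', the Hodge-structure isomorphism in (c), and in (d)
the step "simple factors isogenous ⟹ A_{Ψ'} = Θg₀⁻¹ for some g₀" — (d) is formalized
from that point on (eq_smul_psi_of_Acorner_eq).
-/
open Pointwise

namespace RfwfReflex

variable {G : Type*} [Group G]

/-- CM-type property for the involution `c`: `G = Φ ⊔ cΦ`, pointwise. (paper l.44-45) -/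
def IsCMType (c : G) (Φ : Set G) : Prop := ∀ x : G, x ∈ Φ ↔ c * x ∉ Φ

/-- Right-translation stabiliser property `Θ·u = Θ`, pointwise. (paper l.154: H') -/
def RStab (Θ : Set G) (u : G) : Prop := ∀ x : G, x * u ∈ Θ ↔ x ∈ Θ

/-- `Ψ := φh · Θ⁻¹`. (paper l.155) -/
def psi (φh : G) (Θ : Set G) : Set G := φh • Θ⁻¹

/-- `A_Ψ := {τ : τ⁻¹ φh ∈ Ψ}`. (paper l.149) -/
def Acorner (φh : G) (Ψ : Set G) : Set G := {τ : G | τ⁻¹ * φh ∈ Ψ}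

/-- `Stab(X) := {s : sX = X}` (left stabiliser). (paper l.149) -/
def stabSet (X : Set G) : Set G := {s : G | s • X = X}

/-- Right translate `Θ g⁻¹ = {x : x g ∈ Θ}`. (paper l.158-159, l.182) -/
def rtransl (Θ : Set G) (g : G) : Set G := {x : G | x * g ∈ Θ}

section basic

variable {φh c : G} {Θ X : Set G}

/-- (no docstring in the 2001 source) -/
lemma mem_psi_iff {x : G} : x ∈ psi φh Θ ↔ x⁻¹ * φh ∈ Θ := by
  unfold psi
  rw [Set.mem_smul_set_iff_inv_smul_mem, smul_eq_mul, Set.mem_inv, mul_inv_rev, inv_inv]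

/-- The corner operation is the same operation as `psi`: `A_X = φh · X⁻¹` for every set. -/
lemma Acorner_eq_psi : Acorner φh X = psi φh X := by
  ext τ; exact (mem_psi_iff (Θ := X)).symm

/-- The base point `φh ∈ {1, c}` is central and an involution when `c` is. (paper l.148) -/
lemma phih_central_invol (hφ : φh = 1 ∨ φh = c) (hc2 : c * c = 1)
    (hcen : ∀ g : G, c * g = g * c) :
    (∀ g : G, φh * g = g * φh) ∧ φh * φh = 1 := by
  rcases hφ with h | h <;> subst h
  · exact ⟨fun g => by rw [one_mul, mul_one], one_mul 1⟩
  · exact ⟨hcen, hc2⟩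

/-- (no docstring in the 2001 source) -/
lemma phih_inv (hφ2 : φh * φh = 1) : φh⁻¹ = φh :=
  inv_eq_of_mul_eq_one_right hφ2

/-- `psi φh` is an involution on subsets (for `φh` central with `φh² = 1`).
    This is the mechanism behind parts (b) and (d) of Lemma 3.1. -/
lemma psi_psi (hφc : ∀ g : G, φh * g = g * φh) (hφ2 : φh * φh = 1) :
    psi φh (psi φh X) = X := by
  ext x
  rw [mem_psi_iff, mem_psi_iff, mul_inv_rev, inv_inv, phih_inv hφ2, hφc x, mul_assoc,
    hφ2, mul_one]

end basic

section partA
-- Lemma 3.1(a): Ψ is a CM type of F containing φh, and sΨ = Ψ iff s ∈ H'. (paper l.156)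

variable {φh c : G} {Θ : Set G}

/-- (a), first clause: `Ψ = φh Θ⁻¹` is again a CM type.  Needs only `c² = 1`, `c` central
    and the CM property of `Θ` (no hypothesis on `φh` at all). (paper proof l.166-168) -/
lemma isCMType_psi (hc2 : c * c = 1) (hcen : ∀ g : G, c * g = g * c)
    (hΘ : IsCMType c Θ) : IsCMType c (psi φh Θ) := by
  intro x
  have hcinv : c⁻¹ = c := inv_eq_of_mul_eq_one_right hc2
  have h1 : (c * x)⁻¹ * φh = c * (x⁻¹ * φh) := by
    rw [mul_inv_rev, hcinv, ← hcen x⁻¹, mul_assoc]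
  rw [mem_psi_iff, mem_psi_iff, h1]
  exact hΘ (x⁻¹ * φh)

/-- (a), second clause: `φh ∈ Ψ` (from `1 ∈ Θ`). (paper proof l.167) -/
lemma basePoint_mem_psi (h1 : (1 : G) ∈ Θ) : φh ∈ psi φh Θ := by
  rw [mem_psi_iff, inv_mul_cancel]; exact h1

/-- (a), third clause: `sΨ = Ψ  ↔  Θs = Θ` — the left stabiliser of `Ψ` is the right
    stabiliser `H'` of `Θ`. (paper l.156, proof l.167-168) -/
lemma smul_psi_eq_iff (hφc : ∀ g : G, φh * g = g * φh) {s : G} :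
    s • psi φh Θ = psi φh Θ ↔ RStab Θ s := by
  have hmem : ∀ x : G, x ∈ s • psi φh Θ ↔ (x⁻¹ * φh) * s ∈ Θ := by
    intro x
    rw [Set.mem_smul_set_iff_inv_smul_mem, smul_eq_mul, mem_psi_iff, mul_inv_rev, inv_inv,
      mul_assoc, ← hφc s, ← mul_assoc]
  constructor
  · intro hs y
    have hyy : (φh * y⁻¹)⁻¹ * φh = y := by group
    have hx := Set.ext_iff.mp hs (φh * y⁻¹)
    rw [hmem, mem_psi_iff, hyy] at hx
    exact hx
  · intro hs
    ext x
    rw [hmem, mem_psi_iff]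
    exact hs (x⁻¹ * φh)

/-- (a)/(b) restated as an equality of sets: `Stab(Ψ) = H'`. (paper l.156-158) -/
lemma stabSet_psi (hφc : ∀ g : G, φh * g = g * φh) :
    stabSet (psi φh Θ) = {s : G | RStab Θ s} := by
  ext s; exact smul_psi_eq_iff hφc

end partA

section partB
-- Lemma 3.1(b): A_Ψ = Θ, Stab(Ψ) = H', F*_Ψ = K', Ψ* = θ. (paper l.156-158)

variable {φh c : G} {Θ : Set G}

/-- (b), first clause: `A_Ψ = Θ`. (paper proof l.168-169) -/
lemma Acorner_psi_eq (hφc : ∀ g : G, φh * g = g * φh) (hφ2 : φh * φh = 1) :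
    Acorner φh (psi φh Θ) = Θ := by
  rw [Acorner_eq_psi, psi_psi hφc hφ2]

/-- The right stabiliser `H'` of `Θ` as a subgroup (so that `G ⧸ H'` — the group-theoretic
    image of "restriction to `K' = F^{H'}`" — makes sense). (paper l.154) -/
def rightStab (Θ : Set G) : Subgroup G where
  carrier := {u : G | RStab Θ u}
  one_mem' := fun x => by rw [mul_one]
  mul_mem' := by
    intro u v hu hv x
    rw [← mul_assoc]
    exact (hv (x * u)).trans (hu x)
  inv_mem' := by
    intro u hu x
    have h := (hu (x * u⁻¹)).symm
    rwa [mul_assoc, inv_mul_cancel, mul_one] at h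

/-- (no docstring in the 2001 source) -/
lemma mem_rightStab {Θ : Set G} {u : G} : u ∈ rightStab Θ ↔ RStab Θ u := Iff.rfl

/-- `θ := {u|_{K'} : u ∈ Θ}`, as the image of `Θ` in `G ⧸ H'` (left cosets of `H'`,
    which are exactly the fibres of restriction to the fixed field `K'`). (paper l.154-155) -/
def thetaQ (Θ : Set G) : Set (G ⧸ rightStab Θ) :=
  QuotientGroup.mk '' Θ

/-- `Ψ* := {τ|_{F*_Ψ} : τ ∈ A_Ψ}` for `Ψ = φh Θ⁻¹`, pushed into `G ⧸ H'` through the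
    identifications `A_Ψ = Θ`, `Stab(Ψ) = H'` of (a),(b). -/
def psiStar (φh : G) (Θ : Set G) : Set (G ⧸ rightStab Θ) :=
  QuotientGroup.mk '' Acorner φh (psi φh Θ)

/-- (b), reflex-type clause: `Ψ* = θ`. (paper l.157, proof l.172-173) -/
lemma psiStar_eq_thetaQ (hφc : ∀ g : G, φh * g = g * φh) (hφ2 : φh * φh = 1) :
    psiStar φh Θ = thetaQ Θ := by
  unfold psiStar thetaQ
  rw [Acorner_psi_eq hφc hφ2]

/-- Membership in `θ` is decided by membership in `Θ` (well-definedness: `Θ` is a union of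
    left `H'`-cosets, because `H'` right-stabilises `Θ`). (paper proof l.169-171) -/
lemma mem_thetaQ_iff {x : G} :
    (QuotientGroup.mk x : G ⧸ rightStab Θ) ∈ thetaQ Θ ↔ x ∈ Θ := by
  constructor
  · rintro ⟨y, hy, hyx⟩
    have h : y⁻¹ * x ∈ rightStab Θ := (QuotientGroup.eq).mp hyx
    have := (h y).mpr hy
    rwa [mul_inv_cancel_left] at this
  · intro hx
    exact ⟨x, hx, rfl⟩

/-- `Θ` is induced from `θ`: `Θ` is the preimage of `θ` under restriction. (paper l.170-171:
    "Θ is induced from the CM type θ of K'".) -/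
lemma theta_induced : Θ = (QuotientGroup.mk : G → G ⧸ rightStab Θ) ⁻¹' thetaQ Θ := by
  ext x
  exact (mem_thetaQ_iff).symm

/-- `θ` is a CM type of `K'`: on `G ⧸ H'` the conjugation acts by `mk x ↦ mk (c x)`, and
    `θ` contains exactly one of each pair. (paper l.170: "the CM type θ of K'".) -/
lemma isCMType_thetaQ (hΘ : IsCMType c Θ) {x : G} :
    (QuotientGroup.mk x : G ⧸ rightStab Θ) ∈ thetaQ Θ ↔
      (QuotientGroup.mk (c * x) : G ⧸ rightStab Θ) ∉ thetaQ Θ := by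
  rw [mem_thetaQ_iff, mem_thetaQ_iff]
  exact hΘ x

end partB

section partCD
-- Lemma 3.1(c),(d): translates. (paper l.158-162)

variable {φh c : G} {Θ : Set G} {g₀ s : G}

/-- (c), stabiliser clause: `Stab(g₀ X) = g₀ Stab(X) g₀⁻¹`, elementwise. (paper proof l.175) -/
lemma smul_smul_set_eq_iff {X : Set G} :
    s • (g₀ • X) = g₀ • X ↔ (g₀⁻¹ * s * g₀) • X = X := by
  constructor
  · intro h
    have h' := congrArg (fun Y => g₀⁻¹ • Y) h
    simpa [smul_smul, mul_assoc] using h'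
  · intro h
    have h' := congrArg (fun Y => g₀ • Y) h
    rw [smul_smul] at h'
    have : g₀ * (g₀⁻¹ * s * g₀) = s * g₀ := by group
    rwa [this, ← smul_smul] at h'

/-- (c) for `Ψ = φh Θ⁻¹`: `s ∈ Stab(g₀Ψ)  ↔  g₀⁻¹ s g₀ ∈ H'`. (paper l.158, proof l.175) -/
lemma stab_smul_psi_iff (hφc : ∀ g : G, φh * g = g * φh) :
    s • (g₀ • psi φh Θ) = g₀ • psi φh Θ ↔ RStab Θ (g₀⁻¹ * s * g₀) :=
  (smul_smul_set_eq_iff).trans (smul_psi_eq_iff hφc)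

/-- (c), corner clause, for an arbitrary set: `A_{g₀ X} = (A_X) g₀⁻¹`. (paper proof l.175-176) -/
lemma Acorner_smul {X : Set G} :
    Acorner φh (g₀ • X) = rtransl (Acorner φh X) g₀ := by
  ext τ
  show τ⁻¹ * φh ∈ g₀ • X ↔ (τ * g₀)⁻¹ * φh ∈ X
  rw [Set.mem_smul_set_iff_inv_smul_mem, smul_eq_mul, mul_inv_rev, mul_assoc]

/-- (c) for `Ψ`: `A_{g₀Ψ} = Θ g₀⁻¹`. (paper l.158-159) -/
lemma Acorner_smul_psi (hφc : ∀ g : G, φh * g = g * φh) (hφ2 : φh * φh = 1) :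
    Acorner φh (g₀ • psi φh Θ) = rtransl Θ g₀ := by
  rw [Acorner_smul, Acorner_psi_eq hφc hφ2]

/-- (no docstring in the 2001 source) -/
lemma psi_rtransl (hφc : ∀ g : G, φh * g = g * φh) :
    psi φh (rtransl Θ g₀) = g₀ • psi φh Θ := by
  ext x
  rw [mem_psi_iff, Set.mem_smul_set_iff_inv_smul_mem, smul_eq_mul, mem_psi_iff]
  show (x⁻¹ * φh) * g₀ ∈ Θ ↔ (g₀⁻¹ * x)⁻¹ * φh ∈ Θ
  have h : (g₀⁻¹ * x)⁻¹ * φh = (x⁻¹ * φh) * g₀ := by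
    rw [mul_inv_rev, inv_inv, mul_assoc, ← hφc g₀, ← mul_assoc]
  rw [h]

/-- (d), combinatorial core: if `A_{Ψ'} = Θ g₀⁻¹` (the conclusion of the isogeny
    classification step, [ST II.§5], which is not formalized), then `Ψ' = g₀ Ψ`.
    (paper l.160-162, proof l.178-182, last sentence.) -/
theorem eq_smul_psi_of_Acorner_eq (hφc : ∀ g : G, φh * g = g * φh) (hφ2 : φh * φh = 1)
    {Ψ' : Set G} (h : Acorner φh Ψ' = rtransl Θ g₀) : Ψ' = g₀ • psi φh Θ := by
  have h1 : psi φh (Acorner φh Ψ') = Ψ' := by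
    rw [Acorner_eq_psi, psi_psi hφc hφ2]
  rw [← h1, h, psi_rtransl hφc]

end partCD

end RfwfReflex



end HodgeCM.Prior.ReflexLemma
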